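import Summits.Parity.BatemanHorn.Theorems.BalancedSemiprimeLayer.Negative.TightAtX

/-!
# `BalancedSemiprimeLayer` (crux stmt-Parity-9469): `irreducible` is load-bearing

Negative-side load-bearing analysis (cdisprove, refuter-cdisprove-stmt-Parity-9469-g2-0), PROVED:
the crux with the hypothesis `irreducible` of `IsBatemanHornSystem` DROPPED is FALSE. Witness: the
system `(X²)` (positive leading coefficient, trivially pairwise non-associated, no fixed prime
divisor). Its values `n²` are `x^{1−δ}`-rough iff `n` is, so its crux count is
`Φ(x, x^{1−δ}) ∼ x/log x` (`tendsto_card_roughIcc_one_sub_mul_log_div`), while `P_{(X²)} = 0` and the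
tolerance is `ε·x/log x`. (Irreducibility matters through REPEATED factors; a squarefree reducible
coordinate such as `X(X+2)` would be harmless — its rough values are prime pairs.)
-/

namespace Summit.Parity.BatemanHorn.Theorems.BalancedSemiprimeLayer.Negative

open Filter Finset Polynomial Real
open scoped Topology
open Literature.NumberTheory.Sieve

/-- `(X²)` has no fixed prime divisor (`ω(p) = 1`). [folklore] -/
theorem hasNoFixedPrimeDivisor_X_sq : HasNoFixedPrimeDivisor ![(X ^ 2 : ℤ[X])] := by
  intro p hp
  unfold polyRootCountMod
  simp only [Fin.prod_univ_one, Matrix.cons_val_fin_one, eval_pow, eval_X]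
  simp only [sq]
  rw [card_filter_range_dvd_mul_self hp]
  exact hp.one_lt

/-- **Any proof of the crux must use `irreducible`**: with that hypothesis dropped the statement is
false (witness `(X²)`, `ε = 1/2`). [folklore] -/
theorem balancedSemiprimeLayer_false_without_irreducible :
    ¬ ∀ (k : ℕ) (f : Fin k → ℤ[X]), (∀ i, 0 < (f i).leadingCoeff) →
      (Pairwise fun i j => ¬Associated (f i) (f j)) → HasNoFixedPrimeDivisor f →
        ∀ ε : ℝ, 0 < ε → ∃ δ : ℝ, 0 < δ ∧ δ ≤ 1 / 4 ∧ ∀ᶠ x : ℕ in atTop,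
          (((Icc 1 x).filter (fun n : ℕ => ∀ i, 0 < (f i).eval (n : ℤ) ∧
            ∀ p ∈ range ⌈(x : ℝ) ^ (((f i).natDegree : ℝ) * (1 - δ) / 2)⌉₊,
              p.Prime → ¬ ((p : ℤ) ∣ (f i).eval (n : ℤ)))).card : ℝ) ≤
            (polyPrimeCount f x : ℝ) + ε * (x : ℝ) / Real.log x ^ k := by
  intro h
  have hlc : ∀ i, 0 < (![(X ^ 2 : ℤ[X])] i).leadingCoeff := by
    intro i; fin_cases i; simp
  obtain ⟨δ, hδ0, hδ, hev⟩ :=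
    h 1 ![X ^ 2] hlc Subsingleton.pairwise hasNoFixedPrimeDivisor_X_sq (1 / 2) (by norm_num)
  have hgt := eventually_mul_div_log_lt (tendsto_card_roughIcc_one_sub_mul_log_div hδ0 hδ)
    (by norm_num : (1 : ℝ) / 2 < 1)
  obtain ⟨x, h1, h2⟩ := (hev.and hgt).exists
  rw [card_cruxFilter_X_sq, polyPrimeCount_X_sq] at h1
  norm_num at h1
  linarith

end Summit.Parity.BatemanHorn.Theorems.BalancedSemiprimeLayer.Negative
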